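import Literature.AlgebraicGeometry.Resolution.ResolutionLU
import Literature.AlgebraicGeometry.Resolution.ProjectiveSpaceRegular
import Mathlib.AlgebraicGeometry.Noetherian
import Mathlib.AlgebraicGeometry.Morphisms.UniversallyClosed
import Mathlib.AlgebraicGeometry.FunctionField
import HarnessLib

/-!
# Stub `stub_finiteRegularAtlas` of crux stmt-ResolutionOfSingularities-18076
# (`RuledResidues.NonRuledCofinite`, line `regular-atlas`)

**Finite regular atlas of the Riemann–Zariski space over an affine model from a resolution.**
If `Spec A` (`A` a Noetherian domain, `K = Frac A`) has a resolution of singularities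
`π : X → Spec A`, then there are FINITELY MANY finitely generated `A`-subalgebras `T` of `K`, each
a regular ring, such that every valuation ring `O ⊇ A` of `K` contains one of them
(`exists_finite_regularAtlas`); over a ground field `k` the charts become finitely generated
regular `k`-subalgebras `B ⊇ R` (`stub_finiteRegularAtlas`, the registered signature).

Proof (the tree's `exists_fg_regular_of_hasResolution`, ResolutionLU.lean, made UNIFORM in the
valuation ring): `X` is integral (regular stalks are domains, so `X` is reduced; `π⁻¹U ≅ U` is an
irreducible dense open) and quasi-compact (`π` is proper), so it has a finite affine cover `t`;
for `V ∈ t` all INJECTIVE `A`-algebra maps `Γ(X, V) → K` coincide (`K = Frac A`: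
`ringHom_eq_of_injective`), so the set of their images is finite; each image is isomorphic to
`Γ(X, V)`, a regular ring (`Scheme.IsRegular.isRegularRing_of_isAffineOpen`), and of finite type
over `A`; and for a valuation ring `O ⊇ A` the valuative criterion of properness gives a centre
`x ∈ V ∈ t` with `Γ(X, V) → 𝒪_{X,x} → O → K` injective (germs are injective on an integral
scheme; `𝒪_{X,x} → O` is injective by birationality, verbatim from ResolutionLU), whose image
therefore is one of the finitely many charts and lies in `O`.
-/

noncomputable section

set_option linter.dupNamespace false

open CategoryTheory AlgebraicGeometry TopologicalSpace IsLocalRing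
open Literature.AlgebraicGeometry.Resolution

namespace Summit.ResolutionOfSingularities.ResolutionOfSingularities.Theorems.RuledResiduesNonRuledCofinite

universe u

/-! ## Uniqueness of embeddings into the fraction field -/

/-- **Injective `A`-embeddings into `Frac A` are unique.** If `φ, ψ : S → K = Frac A` are ring
maps compatible with `α : A → S` and `φ` is injective, then `ψ = φ`: writing `φ c = a / b`,
injectivity gives `α b · c = α a` in `S`, whence `ψ c = a / b`. [folklore] -/
theorem ringHom_eq_of_injective {A K S : Type*} [CommRing A] [IsDomain A] [Field K] [Algebra A K]
    [IsFractionRing A K] [CommRing S] (α : A →+* S) (φ ψ : S →+* K)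
    (hφ : ∀ a, φ (α a) = algebraMap A K a) (hψ : ∀ a, ψ (α a) = algebraMap A K a)
    (hinj : Function.Injective φ) : ψ = φ := by
  ext c
  obtain ⟨a, b, hb, e⟩ := IsFractionRing.div_surjective (A := A) (φ c)
  have hb0 : algebraMap A K b ≠ 0 := IsFractionRing.to_map_ne_zero_of_mem_nonZeroDivisors hb
  have h1 : φ (α b * c) = φ (α a) := by
    rw [map_mul, hφ, hφ, ← e, mul_div_cancel₀ _ hb0]
  have h2 : α b * c = α a := hinj h1
  have h3 : algebraMap A K b * ψ c = algebraMap A K a := by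
    have := congrArg ψ h2
    rwa [map_mul, hψ, hψ] at this
  rw [← e, eq_div_iff hb0, mul_comm]
  exact h3

/-! ## The source of a resolution of an integral affine scheme is integral -/

/-- The source `X` of a resolution `π : X → Spec A` of a domain is an integral scheme: it is
reduced because its local rings are regular, hence domains (Matsumura, Thm. 14.3), and
irreducible because the dense open `π⁻¹U ≅ U` is irreducible. [folklore] -/
theorem isIntegral_of_isResolution {A : Type u} [CommRing A] [IsDomain A] {X : Scheme.{u}}
    (π : X ⟶ Spec (.of A)) (hπ : IsResolution π) : IsIntegral X := by
  obtain ⟨U, hUd, hUd', hUiso⟩ := hπ.isBirational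
  haveI : IsDomain (CommRingCat.of A) := ‹IsDomain A›
  -- reduced
  haveI : ∀ x : X, _root_.IsReduced (X.presheaf.stalk x) := fun x => by
    haveI := hπ.isRegular x
    haveI := isDomain_of_isRegularLocalRing (X.presheaf.stalk x)
    infer_instance
  haveI : IsReduced X := isReduced_of_isReduced_stalk X
  -- irreducible
  haveI : Nonempty (U : Scheme.{u}) := by
    haveI : Nonempty (Spec (.of A)) := ⟨(⊥ : PrimeSpectrum A)⟩
    obtain ⟨y, hy⟩ := hUd.nonempty
    exact ⟨⟨y, hy⟩⟩
  haveI := hUiso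
  haveI : IsIntegral (π ⁻¹ᵁ U : Scheme.{u}) := IsIntegral.of_isIso (inv (π ∣_ U))
  have hirr : IsIrreducible ((π ⁻¹ᵁ U : X.Opens) : Set X) := by
    rw [← Scheme.Opens.range_ι, ← Set.image_univ]
    exact (IrreducibleSpace.isIrreducible_univ _).image _
      (π ⁻¹ᵁ U).ι.continuous.continuousOn
  haveI : IrreducibleSpace X := by
    rw [irreducibleSpace_def]
    have h := hirr.closure
    rwa [hUd'.closure_eq] at h
  exact isIntegral_of_irreducibleSpace_of_isReduced X

/-! ## The finite regular atlas over a Noetherian domain -/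

/-- **Finite regular atlas from a resolution** (folklore; Zariski's "resolution ⇒ local
uniformization" made uniform in the valuation ring). If `Spec A` (`A` a Noetherian domain with
fraction field `K`) has a resolution of singularities, there is a FINITE set `𝓣` of finitely
generated `A`-subalgebras of `K`, each a regular ring, such that every valuation ring `O` of `K`
containing `A` contains some `T ∈ 𝓣`. The charts are the images in `K` of the coordinate rings
of a finite affine cover of the (integral, quasi-compact) resolution under their unique injective
`A`-embeddings; coverage is the valuative criterion of properness. [folklore] -/
theorem exists_finite_regularAtlas {A : Type u} [CommRing A] [IsDomain A] [IsNoetherianRing A]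
    {K : Type u} [Field K] [Algebra A K] [IsFractionRing A K]
    (hres : Scheme.HasResolution (Spec (.of A))) :
    ∃ 𝓣 : Set (Subalgebra A K), 𝓣.Finite ∧ (∀ T ∈ 𝓣, T.FG ∧ IsRegularRing T) ∧
      ∀ O : ValuationSubring K, (∀ a : A, algebraMap A K a ∈ O) →
        ∃ T ∈ 𝓣, T.toSubring ≤ O.toSubring := by
  classical
  obtain ⟨X, π, hπ⟩ := hres
  haveI := hπ.isProper
  haveI : IsDomain (CommRingCat.of A) := ‹IsDomain A›
  haveI : IsNoetherianRing (CommRingCat.of A) := ‹IsNoetherianRing A›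
  haveI : IsIntegral X := isIntegral_of_isResolution π hπ
  haveI : IsLocallyNoetherian X := LocallyOfFiniteType.isLocallyNoetherian π
  haveI : CompactSpace X := QuasiCompact.compactSpace_of_compactSpace π
  -- a finite affine cover `t`
  obtain ⟨t, ht⟩ : ∃ t : Finset X.affineOpens, (Set.univ : Set X) ⊆ ⋃ V ∈ t, ((V : X.Opens) : Set X) :=
    isCompact_univ.elim_finite_subcover (fun V : X.affineOpens => ((V : X.Opens) : Set X))
      (fun V => (V : X.Opens).isOpen) fun x _ => by
        obtain ⟨_, ⟨V, hV, rfl⟩, hxV, -⟩ :=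
          X.isBasis_affineOpens.exists_subset_of_mem_open (Set.mem_univ x) isOpen_univ
        exact Set.mem_iUnion.mpr ⟨⟨V, hV⟩, hxV⟩
  -- the structure maps `α V : A → Γ(X, V)` and the admissible ("good") embeddings `Γ(X, V) ↪ K`
  let α : ∀ V : X.Opens, A →+* Γ(X, V) := fun V =>
    (π.appLE ⊤ V le_top).hom.comp (Scheme.ΓSpecIso (.of A)).inv.hom
  let Good : ∀ V : X.Opens, (Γ(X, V) →+* K) → Prop := fun V φ =>
    Function.Injective φ ∧ ∀ a, φ (α V a) = algebraMap A K a
  let S : X.affineOpens → Set (Subalgebra A K) := fun V =>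
    {T | ∃ φ : Γ(X, V) →+* K, Good V φ ∧ T.toSubring = φ.range}
  refine ⟨{T | (T.FG ∧ IsRegularRing T) ∧ ∃ V ∈ t, T ∈ S V}, ?_, fun T hT => hT.1, ?_⟩
  · -- finiteness: over each chart the good embeddings, hence their images, coincide
    refine Set.Finite.subset (t.finite_toSet.biUnion (t := S) fun V _ => ?_) ?_
    · refine Set.Subsingleton.finite ?_
      rintro T ⟨φ, hφ, hT⟩ T' ⟨φ', hφ', hT'⟩
      have e : φ' = φ := ringHom_eq_of_injective (α V) φ φ' hφ.2 hφ'.2 hφ.1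
      apply Subalgebra.toSubring_injective
      rw [hT, hT', e]
    · rintro T ⟨-, V, hV, hTV⟩
      exact Set.mem_biUnion hV hTV
  · -- coverage: the valuative criterion (verbatim `exists_fg_regular_of_hasResolution`)
    intro O hAO
    obtain ⟨U, hUd, -, hUiso⟩ := hπ.isBirational
    let φ₀ : A →+* O := (algebraMap A K).codRestrict O.toSubring hAO
    let ιOK : CommRingCat.of O ⟶ CommRingCat.of K := CommRingCat.ofHom (algebraMap O K)
    let i₂ : Spec (.of O) ⟶ Spec (.of A) := Spec.map (CommRingCat.ofHom φ₀)
    let g : Spec (.of K) ⟶ Spec (.of A) := Spec.map (CommRingCat.ofHom (algebraMap A K))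
    have hg : Spec.map ιOK ≫ i₂ = g := by
      rw [← Spec.map_comp]
      rfl
    let q : Spec (.of K) := closedPoint K
    have hgq : g q = (⊥ : PrimeSpectrum A) := by
      change PrimeSpectrum.comap (algebraMap A K) (closedPoint K) = ⊥
      ext1
      rw [PrimeSpectrum.comap_asIdeal]
      change Ideal.comap (algebraMap A K) (maximalIdeal K) = ⊥
      rw [maximalIdeal_eq_bot, ← RingHom.ker_eq_comap_bot, RingHom.ker_eq_bot_iff_eq_zero]
      intro a ha
      exact (IsFractionRing.injective A K) (by rw [ha, map_zero])
    have hbotU : ((⊥ : PrimeSpectrum A) : Spec (.of A)) ∈ U := by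
      haveI : Nonempty (Spec (.of A)) := ⟨(⊥ : PrimeSpectrum A)⟩
      obtain ⟨y, hy⟩ := hUd.nonempty
      exact ((PrimeSpectrum.le_iff_specializes _ y).mp bot_le).mem_open U.isOpen hy
    have hrange : Set.range g.base ⊆ Set.range U.ι.base := by
      rw [Scheme.Opens.range_ι]
      rintro _ ⟨p, rfl⟩
      obtain rfl : p = q := Subsingleton.elim _ _
      rw [hgq]; exact hbotU
    let g₁ : Spec (.of K) ⟶ U := IsOpenImmersion.lift U.ι g hrange
    have hg₁ : g₁ ≫ U.ι = g := IsOpenImmersion.lift_fac _ _ _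
    haveI := hUiso
    let j : ↑(π ⁻¹ᵁ U) ⟶ X := (π ⁻¹ᵁ U).ι
    let i₁ : Spec (.of K) ⟶ X := g₁ ≫ inv (π ∣_ U) ≫ j
    have hsq : i₁ ≫ π = Spec.map ιOK ≫ i₂ := by
      rw [hg]
      simp only [i₁, j, Category.assoc, ← morphismRestrict_ι, IsIso.inv_hom_id_assoc, hg₁]
    -- valuative criterion of properness
    have hex : ValuativeCriterion.Existence π := by
      have h := (inferInstance : UniversallyClosed π)
      rw [UniversallyClosed.eq_valuativeCriterion] at h
      exact h.1
    obtain ⟨l, hl₁, hl₂⟩ :=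
      (hex { R := O, K := K, i₁ := i₁, i₂ := i₂, commSq := ⟨hsq⟩ }).exists_lift
    -- the centre `x' = l(𝔪_O)` and its regular (hence integral) local ring
    set c : Spec (.of O) := closedPoint O with hc
    haveI hregx : IsRegularLocalRing (X.presheaf.stalk (l c)) := hπ.isRegular (l c)
    let ψ := Scheme.stalkClosedPointTo l
    -- `ψ : 𝒪_{X,x'} → O` is injective
    have hψ : Function.Injective ψ := by
      let γ₀ : Spec (.of O) := Spec.map ιOK q
      have hγc : γ₀ ⤳ c := IsLocalRing.specializes_closedPoint γ₀
      -- (E1) at the generic point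
      have hE1 : Function.Injective (l.stalkMap γ₀) := by
        have h1 : Function.Injective (g.stalkMap q) := by
          have hF : IsField ((Spec (.of A)).presheaf.stalk (g q)) := by
            refine isField_stalk_of_eq ?_ (Field.toIsField (Spec (.of A)).functionField)
            rw [genericPoint_eq_bot_of_affine, hgq]
          letI := hF.toField
          exact RingHom.injective _
        have h2 : Function.Injective (g₁.stalkMap q) := by
          rw [← stalkMap_injective_congr hg₁, Scheme.Hom.stalkMap_comp] at h1
          exact Function.Injective.of_comp_right h1
            (ConcreteCategory.bijective_of_isIso (U.ι.stalkMap (g₁ q))).2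
        have h3 : Function.Injective (i₁.stalkMap q) := by
          change Function.Injective ((g₁ ≫ inv (π ∣_ U) ≫ j).stalkMap q)
          rw [Scheme.Hom.stalkMap_comp]
          exact h2.comp (ConcreteCategory.bijective_of_isIso ((inv (π ∣_ U) ≫ j).stalkMap _)).1
        rw [← stalkMap_injective_congr hl₁, Scheme.Hom.stalkMap_comp] at h3
        have h4 : Function.Injective ((Spec.map ιOK).stalkMap q ∘ l.stalkMap γ₀) := h3
        exact Function.Injective.of_comp h4
      -- (E2) generisation on `X` at the domain `𝒪_{X,x'}`
      have hE2 := stalkSpecializes_injective_of_isDomain (l.base.hom.map_specializes hγc)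
      have hE := Scheme.Hom.stalkSpecializes_stalkMap l γ₀ c hγc
      have hcomp : Function.Injective
          (l.stalkMap c ≫ (Spec (.of O)).presheaf.stalkSpecializes hγc) := by
        rw [← hE, CategoryTheory.hom_comp]
        exact hE1.comp hE2
      rw [CategoryTheory.hom_comp] at hcomp
      have hl : Function.Injective (l.stalkMap c) := Function.Injective.of_comp hcomp
      change Function.Injective (l.stalkMap c ≫ (stalkClosedPointIso (.of O)).hom)
      rw [CategoryTheory.hom_comp]
      exact (ConcreteCategory.bijective_of_isIso (stalkClosedPointIso (.of O)).hom).1.comp hl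
    -- a chart `V ∈ t` containing the centre; it is of finite type over `A`
    have hx := ht (Set.mem_univ (l c))
    rw [Set.mem_iUnion₂] at hx
    obtain ⟨V, hVt, hxV⟩ := hx
    replace hxV : l c ∈ (V : X.Opens) := hxV
    have hV : IsAffineOpen (V : X.Opens) := V.2
    have hft : (π.appLE ⊤ V le_top).hom.FiniteType :=
      HasRingHomProperty.appLE (P := @LocallyOfFiniteType) π inferInstance ⟨⊤, isAffineOpen_top _⟩
        V le_top
    have hα : (α V).FiniteType :=
      hft.comp (RingHom.FiniteType.of_surjective _
        (Scheme.ΓSpecIso (.of A)).symm.commRingCatIsoToRingEquiv.surjective)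
    let β : Γ(X, V) →+* O := ψ.hom.comp (X.presheaf.germ V (l c) hxV).hom
    -- compatibility `β ∘ α = (A → O)`
    have key1 : π.appLE ⊤ V le_top ≫ X.presheaf.germ V (l c) hxV =
        (Spec (.of A)).presheaf.germ ⊤ (π (l c)) trivial ≫ π.stalkMap (l c) := by
      rw [Scheme.Hom.germ_stalkMap, Scheme.Hom.appLE, Category.assoc, TopCat.Presheaf.germ_res]
    have key2 : (Spec (.of A)).presheaf.germ ⊤ ((l ≫ π) c) trivial ≫
        Scheme.stalkClosedPointTo (l ≫ π) =
          (Scheme.ΓSpecIso (.of A)).hom ≫ CommRingCat.ofHom φ₀ := by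
      rw [germ_stalkClosedPointTo_congr hl₂ ⊤ trivial]
      exact Scheme.germ_stalkClosedPointTo_Spec (CommRingCat.ofHom φ₀)
    have key3 : (Spec (.of A)).presheaf.germ ⊤ (π (l c)) trivial ≫ π.stalkMap (l c) ≫ ψ =
        (Scheme.ΓSpecIso (.of A)).hom ≫ CommRingCat.ofHom φ₀ := by
      rw [← key2, Scheme.stalkClosedPointTo_comp]
      rfl
    have key : (Scheme.ΓSpecIso (.of A)).inv ≫ π.appLE ⊤ V le_top ≫
        X.presheaf.germ V (l c) hxV ≫ ψ = CommRingCat.ofHom φ₀ := by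
      rw [← Category.assoc (π.appLE ⊤ V le_top), key1, Category.assoc, key3,
        Iso.inv_hom_id_assoc]
    have hβα : ∀ a, β (α V a) = φ₀ a := fun a => by
      have := ConcreteCategory.congr_hom key a
      simp only [CategoryTheory.comp_apply, CommRingCat.hom_ofHom] at this
      exact this
    -- the embedding `γ : Γ(X, V) → O → K` is a good one
    let γ : Γ(X, V) →+* K := (algebraMap O K).comp β
    have hγinj : Function.Injective γ :=
      Subtype.val_injective.comp (hψ.comp (germ_injective_of_isIntegral X (l c) hxV))
    have hγα : ∀ a, γ (α V a) = algebraMap A K a := fun a => by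
      change algebraMap O K (β (α V a)) = algebraMap A K a
      rw [hβα]; rfl
    -- its image `T`, a finitely generated regular `A`-subalgebra of `O`
    letI : Algebra A Γ(X, V) := (α V).toAlgebra
    haveI : Algebra.FiniteType A Γ(X, V) := hα
    let γa : Γ(X, V) →ₐ[A] K := { γ with commutes' := hγα }
    let T : Subalgebra A K := γa.range
    have hTfg : T.FG := by
      change (γa.range).FG
      rw [← Algebra.map_top]; exact Subalgebra.FG.map _ Algebra.FiniteType.out
    have hTO : T.toSubring ≤ O.toSubring := by
      rintro _ ⟨b, rfl⟩; exact (β b).2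
    have hTrange : T.toSubring = γ.range := by
      ext z
      exact ⟨fun ⟨b, hb⟩ => ⟨b, hb⟩, fun ⟨b, hb⟩ => ⟨b, hb⟩⟩
    haveI : IsRegularRing Γ(X, V) := hπ.isRegular.isRegularRing_of_isAffineOpen hV
    have hTreg : IsRegularRing T :=
      IsRegularRing.of_ringEquiv (AlgEquiv.ofInjective γa hγinj).toRingEquiv
    exact ⟨T, ⟨⟨hTfg, hTreg⟩, V, hVt, γ, ⟨hγinj, hγα⟩, hTrange⟩, hTO⟩

/-! ## Over a ground field: the registered stub -/

/-- Regularity of a subalgebra depends only on its underlying subring. [folklore] -/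
theorem isRegularRing_of_toSubring_eq {K : Type*} [Field K] {k A : Type*} [CommRing k]
    [CommRing A] [Algebra k K] [Algebra A K] (B : Subalgebra k K) (T : Subalgebra A K)
    (e : B.toSubring = T.toSubring) (h : IsRegularRing T) : IsRegularRing B := by
  have h' : IsRegularRing T.toSubring := h
  have h'' : IsRegularRing B.toSubring := IsRegularRing.of_ringEquiv (RingEquiv.subringCongr e).symm
  exact h''

/-- `k[s₀ ∪ t] = (k[s₀])[t]` at the level of underlying subrings. [folklore] -/
theorem toSubring_adjoin_union_eq {k K : Type*} [Field k] [Field K] [Algebra k K] (s₀ t : Set K)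
    (T : Subalgebra (Algebra.adjoin k s₀) K) (ht : Algebra.adjoin (Algebra.adjoin k s₀) t = T) :
    (Algebra.adjoin k (s₀ ∪ t)).toSubring = T.toSubring := by
  subst ht
  rw [Algebra.adjoin_union_eq_adjoin_adjoin]
  rfl

/-- **STUB `stub_finiteRegularAtlas` (crux `NonRuledCofinite`, line `regular-atlas`): finite
regular atlas of the Riemann–Zariski space over an affine model from a resolution.** If the
affine model `R` of `K/k` (`R` finitely generated, `Frac R = K`) has a resolution of
singularities, there are finitely many finitely generated REGULAR `k`-subalgebras `B ⊇ R` of `K`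
such that every valuation ring of `K` containing `R` contains one of them
(`exists_finite_regularAtlas` over the Noetherian domain `R`, the charts `T = R[t]` re-read as
`k[s₀ ∪ t]`). [folklore] -/
theorem stub_finiteRegularAtlas (k K : Type) [Field k] [Field K] [Algebra k K] (R : Subalgebra k K)
    (hR : R.FG) (hfr : IsFractionRing R K)
    (hres : Literature.AlgebraicGeometry.Resolution.Scheme.HasResolution (Spec (CommRingCat.of R))) :
    ∃ 𝓑 : Set (Subalgebra k K), 𝓑.Finite ∧
      (∀ B ∈ 𝓑, R ≤ B ∧ B.FG ∧ IsRegularRing B) ∧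
      ∀ W : ValuationSubring K, R.toSubring ≤ W.toSubring → ∃ B ∈ 𝓑, B.toSubring ≤ W.toSubring := by
  classical
  obtain ⟨s₀, rfl⟩ := hR
  haveI : Algebra.FiniteType k (Algebra.adjoin k (s₀ : Set K)) :=
    (Subalgebra.fg_iff_finiteType _).mp ⟨s₀, rfl⟩
  haveI : IsNoetherianRing (Algebra.adjoin k (s₀ : Set K)) :=
    Algebra.FiniteType.isNoetherianRing k _
  haveI := hfr
  obtain ⟨𝓣, h𝓣fin, h𝓣, hcov⟩ :=
    exists_finite_regularAtlas (A := Algebra.adjoin k (s₀ : Set K)) (K := K) hres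
  -- re-read a chart `T = R[t]` as the `k`-subalgebra `k[s₀ ∪ t]`
  let toK : Subalgebra (Algebra.adjoin k (s₀ : Set K)) K → Subalgebra k K := fun T =>
    if h : T.FG then Algebra.adjoin k ((s₀ : Set K) ∪ (h.choose : Set K)) else ⊥
  have htoK : ∀ T : Subalgebra (Algebra.adjoin k (s₀ : Set K)) K, T.FG →
      (toK T).toSubring = T.toSubring ∧ Algebra.adjoin k (s₀ : Set K) ≤ toK T ∧ (toK T).FG := by
    intro T hT
    have e1 : toK T = Algebra.adjoin k ((s₀ : Set K) ∪ (hT.choose : Set K)) := dif_pos hT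
    refine ⟨?_, ?_, ?_⟩
    · rw [e1]
      exact toSubring_adjoin_union_eq _ _ T hT.choose_spec
    · rw [e1]
      exact Algebra.adjoin_mono Set.subset_union_left
    · rw [e1]
      exact ⟨s₀ ∪ hT.choose, by push_cast; rfl⟩
  refine ⟨toK '' 𝓣, h𝓣fin.image toK, ?_, ?_⟩
  · rintro _ ⟨T, hT, rfl⟩
    obtain ⟨hTfg, hTreg⟩ := h𝓣 T hT
    obtain ⟨e, hle, hfg⟩ := htoK T hTfg
    exact ⟨hle, hfg, isRegularRing_of_toSubring_eq _ _ e hTreg⟩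
  · intro W hRW
    obtain ⟨T, hT, hTW⟩ := hcov W fun a => hRW a.2
    refine ⟨toK T, ⟨T, hT, rfl⟩, ?_⟩
    rw [(htoK T (h𝓣 T hT).1).1]
    exact hTW

end Summit.ResolutionOfSingularities.ResolutionOfSingularities.Theorems.RuledResiduesNonRuledCofinite

end
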